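import Summits.CriticalPhenomena.Ising3DConformalLimit.Theorems.AnomalousForcesInteractionEtaPositiveSusceptibilityForm
import Summits.CriticalPhenomena.Ising3DConformalLimit.Theorems.InverseSquareTelemetryInverseSquareLawAxialTelemetryFromPowerLaw
import HarnessLib

/-!
# Crux `EtaPositive` (stmt-CriticalPhenomena-2600): the Källén–Lehmann (spectral) currency

Support file for crux `EtaPositive := ∃ κ > 0, C, ∀ x ≠ 0, G(x) ≤ C ‖x‖^{-(1+κ)}` of route
`AnomalousForcesInteraction` (sub-problem `Ising3DConformalLimit`), `G(x) = ⟨σ₀σ_x⟩⁺_{β_c(3),0}`,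
`G_n := G(n e₁)`.

By reflection positivity of the transfer matrix the critical axis two-point function of the
nearest-neighbour Ising model on `ℤ³` is a HAUSDORFF MOMENT SEQUENCE: `G_n = ∫_{[0,1]} λⁿ dν(λ)` for a
finite positive measure `ν` (Aizenman–Duminil-Copin 2021 Prop. 8.6 — PROVED in the tree,
`AizenmanDuminilCopin2021_prop_8_6_holds`; at `β_c(3)`: `AxialTelemetry.axis_hausdorffMoment`; `λ = e^{-a}`,
`a` the transfer-matrix energy above the ground state). This file shows that the crux is EXACTLY a
statement about the spectral weight at the bottom of the spectrum (`λ → 1`, `a → 0`):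

  `EtaPositive ⟺ ν([1-ε, 1]) ≤ C ε^{1+κ}` for some `κ > 0`, all `ε ∈ (0,1]`

(`EtaPositive_iff_spectral_gain`, existential in `ν`; `spectral_gain_of_EtaPositive` for EVERY representing
`ν`). For the massless lattice free field the spectral weight is `∝ ε` near the threshold (`η = 0`); an
anomalous dimension `η > 0` is the statement that the single-particle weight at threshold VANISHES
(`Z = 0`) at the power rate `ε^{1+η}` — the Källén–Lehmann form of the crux, in which transfer-matrix /
reflection-positivity routes (items `AxisKallenLehmann` stmt-6328, `ThresholdDilation`, `AxialHelsonCone`)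
operate.

Real-analysis core (abstract finite measure `ν` on `ℝ` carried by `[0,1]`, moments `∫ tⁿ dν`):
* `measureReal_Icc_le_of_moments_le` — moments `≤ C n^{-(1+κ)}` ⟹ `ν([1-ε,1]) ≤ (2C+1) 4^{1+κ} ε^{1+κ}`
  (Bernoulli: `tⁿ ≥ (1 - 1/(2n))ⁿ ≥ 1/2` on `[1-ε, 1]` for `n = ⌊1/(2ε)⌋`).
* `moments_le_of_measureReal_Icc_le` — `ν([1-ε,1]) ≤ C ε^{1+κ}` (all `ε > 0`, `κ ≤ 1`) ⟹ moments
  `≤ 49 C n^{-(1+κ)}` (dyadic layer-cake: on `[0,1]`, `tⁿ ≤ 𝟙[t ≥ 1-1/n] + Σ_{j<n} e^{-2^j} 𝟙[t ≥ 1-2^{j+1}/n]`,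
  and `Σ_j e^{-2^j} 4^{j+1} ≤ 48` from `e^x ≥ x³/6`).

Unconditional (standard axioms; Prop. 8.6 is DISCHARGED in the tree); also `EtaPositive_iff_axis_gain` (p165244).
-/

noncomputable section

namespace Summit.CriticalPhenomena.Ising3DConformalLimit.AnomalousForcesInteractionEtaPositive

open MeasureTheory Set Finset Literature.Probability.LatticeModels
open Summit.CriticalPhenomena.Ising3DConformalLimit.Theorems (AxialTelemetry.ae_mem_Icc
  AxialTelemetry.integrable_pow AxialTelemetry.axis_hausdorffMoment)

/-! ### Real analysis: Hausdorff moment sequences with a power gain -/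

section Moments

variable {ν : Measure ℝ} [IsFiniteMeasure ν]

/- The a.e.-membership and integrability helpers for a finite measure carried by `[0,1]` are the landed
`AxialTelemetry.ae_mem_Icc` / `AxialTelemetry.integrable_pow` (route InverseSquareTelemetry, same
Hausdorff-moment setting), reused here. -/

omit [IsFiniteMeasure ν] in
/-- Monomials are a.e. nonnegative against a measure carried by `[0,1]`. -/
theorem pow_ae_nonneg_of_compl_null (hsupp : ν (Icc (0 : ℝ) 1)ᶜ = 0) (n : ℕ) :
    0 ≤ᵐ[ν] fun t : ℝ => t ^ n := by
  filter_upwards [AxialTelemetry.ae_mem_Icc hsupp] with t ht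
  exact pow_nonneg ht.1 n

/-- **Moments with a power gain ⟹ thin spectral weight at the top.** If `ν` is a finite measure carried
by `[0,1]` with total mass `≤ 1` and moments `∫ tⁿ dν ≤ C n^{-(1+κ)}` for all `n ≥ 1` (`κ > 0`), then
`ν([1-ε, 1]) ≤ (2 max C 0 + 1) 4^{1+κ} ε^{1+κ}` for every `ε ∈ (0, 1]`. -/
theorem measureReal_Icc_le_of_moments_le {κ C : ℝ} (hκ : 0 < κ) (hsupp : ν (Icc (0 : ℝ) 1)ᶜ = 0)
    (hmass : ν.real univ ≤ 1)
    (hmom : ∀ n : ℕ, 1 ≤ n → ∫ t, t ^ n ∂ν ≤ C * (n : ℝ) ^ (-(1 + κ))) :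
    ∀ ε : ℝ, 0 < ε → ε ≤ 1 →
      ν.real (Icc (1 - ε) 1) ≤ (2 * max C 0 + 1) * (4 : ℝ) ^ (1 + κ) * ε ^ (1 + κ) := by
  intro ε hε0 hε1
  set C' : ℝ := max C 0 with hC'def
  have hC'0 : 0 ≤ C' := le_max_right _ _
  have h4 : 0 < (4 : ℝ) ^ (1 + κ) := Real.rpow_pos_of_pos (by norm_num) _
  have hε : 0 < ε ^ (1 + κ) := Real.rpow_pos_of_pos hε0 _
  have hmassS : ν.real (Icc (1 - ε) 1) ≤ 1 := (measureReal_mono (subset_univ _)).trans hmass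
  by_cases hq : ε ≤ 1 / 4
  · -- MAIN CASE `ε ≤ 1/4`: `n = ⌊1/(2ε)⌋ ≥ 2`, `ε ≤ 1/(2n)`, `n ≥ 1/(4ε)`
    set n : ℕ := ⌊1 / (2 * ε)⌋₊ with hndef
    have hx : 2 ≤ 1 / (2 * ε) := by
      rw [le_div_iff₀ (by positivity)]; linarith
    have hn2 : 2 ≤ n := by
      rw [hndef]; exact Nat.le_floor (by exact_mod_cast hx)
    have hn1 : 1 ≤ n := by omega
    have hn0 : (0 : ℝ) < n := by exact_mod_cast (show 0 < n by omega)
    have hn1' : (1 : ℝ) ≤ n := by exact_mod_cast hn1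
    have hnle : (n : ℝ) ≤ 1 / (2 * ε) := Nat.floor_le (by positivity)
    have hnge : 1 / (4 * ε) ≤ n := by
      have h1 : 1 / (2 * ε) < (n : ℝ) + 1 := Nat.lt_floor_add_one _
      have h2 : 1 / (4 * ε) + 1 ≤ 1 / (2 * ε) := by
        rw [div_add_one (by positivity), div_le_div_iff₀ (by positivity) (by positivity)]
        nlinarith
      linarith
    -- on `[1-ε, 1]`: `tⁿ ≥ (1 - 1/(2n))ⁿ ≥ 1/2`
    have hεn : ε ≤ 1 / (2 * n) := by
      rw [le_div_iff₀ (by positivity)]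
      rw [le_div_iff₀ (by positivity)] at hnle
      linarith
    have hbern : (1 / 2 : ℝ) ≤ (1 - 1 / (2 * n)) ^ n := by
      have h := one_add_mul_le_pow (show (-2 : ℝ) ≤ -(1 / (2 * n)) by
        have : (0 : ℝ) < 1 / (2 * n) := by positivity
        have : 1 / (2 * (n : ℝ)) ≤ 1 := by rw [div_le_one (by positivity)]; linarith
        linarith) n
      have h2 : 1 + (n : ℝ) * -(1 / (2 * n)) = 1 / 2 := by field_simp; ring
      rw [h2] at h
      simpa [sub_eq_add_neg] using h
    have hpt : ∀ t ∈ Icc (1 - ε) 1, (1 / 2 : ℝ) ≤ t ^ n := by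
      intro t ht
      have h1 : 1 - 1 / (2 * (n : ℝ)) ≤ t := by linarith [ht.1]
      have h0 : 0 ≤ 1 - 1 / (2 * (n : ℝ)) := by
        have : 1 / (2 * (n : ℝ)) ≤ 1 := by rw [div_le_one (by positivity)]; linarith
        linarith
      exact hbern.trans (pow_le_pow_left₀ h0 h1 n)
    -- integrate over `[1-ε, 1]`
    have hint : Integrable (fun t : ℝ => t ^ n) ν := AxialTelemetry.integrable_pow hsupp n
    have hlow : (1 / 2 : ℝ) * ν.real (Icc (1 - ε) 1) ≤ ∫ t in Icc (1 - ε) 1, t ^ n ∂ν := by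
      have h1 : ∫ _ in Icc (1 - ε) 1, (1 / 2 : ℝ) ∂ν ≤ ∫ t in Icc (1 - ε) 1, t ^ n ∂ν :=
        setIntegral_mono_on (integrable_const _).integrableOn hint.integrableOn measurableSet_Icc hpt
      rw [setIntegral_const, smul_eq_mul, mul_comm] at h1
      exact h1
    have hup : ∫ t in Icc (1 - ε) 1, t ^ n ∂ν ≤ ∫ t, t ^ n ∂ν :=
      setIntegral_le_integral hint (pow_ae_nonneg_of_compl_null hsupp n)
    have hmomn : ∫ t, t ^ n ∂ν ≤ C' * (n : ℝ) ^ (-(1 + κ)) :=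
      (hmom n hn1).trans (mul_le_mul_of_nonneg_right (le_max_left _ _) (Real.rpow_nonneg hn0.le _))
    -- `n^{-(1+κ)} ≤ (4ε)^{1+κ}`
    have hnpow : (n : ℝ) ^ (-(1 + κ)) ≤ (4 : ℝ) ^ (1 + κ) * ε ^ (1 + κ) := by
      have h1 : (n : ℝ) ^ (-(1 + κ)) ≤ (1 / (4 * ε)) ^ (-(1 + κ)) :=
        Real.rpow_le_rpow_of_nonpos (by positivity) hnge (by linarith)
      have h2 : (1 / (4 * ε)) ^ (-(1 + κ)) = (4 : ℝ) ^ (1 + κ) * ε ^ (1 + κ) := by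
        rw [Real.rpow_neg (by positivity), ← Real.inv_rpow (by positivity), one_div, inv_inv,
          Real.mul_rpow (by norm_num) hε0.le]
      rw [← h2]; exact h1
    calc ν.real (Icc (1 - ε) 1) ≤ 2 * (C' * (n : ℝ) ^ (-(1 + κ))) := by linarith
      _ ≤ 2 * (C' * ((4 : ℝ) ^ (1 + κ) * ε ^ (1 + κ))) := by gcongr
      _ = 2 * C' * (4 : ℝ) ^ (1 + κ) * ε ^ (1 + κ) := by ring
      _ ≤ (2 * C' + 1) * (4 : ℝ) ^ (1 + κ) * ε ^ (1 + κ) := by nlinarith [mul_pos h4 hε]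
  · -- `ε > 1/4`: total mass
    have hq' : 1 / 4 < ε := not_le.1 hq
    have h1 : (1 : ℝ) ≤ (4 : ℝ) ^ (1 + κ) * ε ^ (1 + κ) := by
      rw [← Real.mul_rpow (by norm_num) hε0.le]
      exact Real.one_le_rpow (by linarith) (by linarith)
    calc ν.real (Icc (1 - ε) 1) ≤ 1 := hmassS
      _ ≤ (4 : ℝ) ^ (1 + κ) * ε ^ (1 + κ) := h1
      _ ≤ (2 * C' + 1) * (4 : ℝ) ^ (1 + κ) * ε ^ (1 + κ) := by nlinarith [mul_pos h4 hε]

/-- `e^{-2^j} 4^{j+1} ≤ 24 · 2^{-j}` (from `e^x ≥ x³/3!` at `x = 2^j`). -/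
theorem exp_neg_two_pow_mul_four_pow_le (j : ℕ) :
    Real.exp (-(2 : ℝ) ^ j) * (4 : ℝ) ^ (j + 1) ≤ 24 * (1 / 2 : ℝ) ^ j := by
  have hx : (0 : ℝ) ≤ (2 : ℝ) ^ j := by positivity
  have h := Real.pow_div_factorial_le_exp ((2 : ℝ) ^ j) hx 3
  have h3 : (Nat.factorial 3 : ℝ) = 6 := by norm_num [Nat.factorial]
  rw [h3, div_le_iff₀ (by norm_num : (0 : ℝ) < 6)] at h
  -- `(2^j)^3 = 8^j = 4^j 2^j`
  have h8 : ((2 : ℝ) ^ j) ^ 3 = (4 : ℝ) ^ j * (2 : ℝ) ^ j := by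
    rw [← pow_mul, ← mul_pow]; norm_num
    rw [show (8 : ℝ) = 2 ^ 3 by norm_num, ← pow_mul, mul_comm]
  have hE : 0 < Real.exp ((2 : ℝ) ^ j) := Real.exp_pos _
  have h2j : 0 < (2 : ℝ) ^ j := by positivity
  rw [Real.exp_neg, one_div, inv_pow]
  rw [h8] at h
  rw [pow_succ, inv_mul_le_iff₀ hE]
  rw [show 24 * ((2 : ℝ) ^ j)⁻¹ = 24 / (2 : ℝ) ^ j by rw [div_eq_mul_inv], mul_div_assoc',
    le_div_iff₀ h2j]
  nlinarith

/-- **Thin spectral weight at the top ⟹ moments with a power gain.** If `ν` is a finite measure carried by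
`[0,1]` with `ν([1-ε, 1]) ≤ C ε^{1+κ}` for every `ε > 0` (`κ ≤ 1`, `C ≥ 0`), then
`∫ tⁿ dν ≤ 49 C n^{-(1+κ)}` for all `n ≥ 1`: on `[0,1]`,
`tⁿ ≤ 𝟙[t ≥ 1 - 1/n] + Σ_{j<n} e^{-2^j} 𝟙[t ≥ 1 - 2^{j+1}/n]` (bracket `t` between consecutive thresholds
and use `(1 - x)ⁿ ≤ e^{-nx}`; `2ⁿ ≥ n` makes the last bracket reach `0`), then integrate. -/
theorem moments_le_of_measureReal_Icc_le {κ C : ℝ} (hκ1 : κ ≤ 1) (hC : 0 ≤ C)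
    (hsupp : ν (Icc (0 : ℝ) 1)ᶜ = 0)
    (htail : ∀ ε : ℝ, 0 < ε → ν.real (Icc (1 - ε) 1) ≤ C * ε ^ (1 + κ)) :
    ∀ n : ℕ, 1 ≤ n → ∫ t, t ^ n ∂ν ≤ 49 * C * (n : ℝ) ^ (-(1 + κ)) := by
  intro n hn
  have hn0 : (0 : ℝ) < n := by exact_mod_cast hn
  -- thresholds `T j = [1 - 2^j/n, 1]`
  set T : ℕ → Set ℝ := fun j => Icc (1 - (2 : ℝ) ^ j / n) 1 with hTdef
  have hTmeas : ∀ j, MeasurableSet (T j) := fun j => measurableSet_Icc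
  -- the dominating simple function
  set φ : ℝ → ℝ := fun t => (T 0).indicator 1 t +
    ∑ j ∈ Finset.range n, Real.exp (-(2 : ℝ) ^ j) * (T (j + 1)).indicator 1 t with hφdef
  have hind0 : ∀ (j : ℕ) (t : ℝ), 0 ≤ (T j).indicator (1 : ℝ → ℝ) t := fun j t =>
    Set.indicator_nonneg (fun _ _ => zero_le_one) t
  have hterm0 : ∀ (j : ℕ) (t : ℝ), 0 ≤ Real.exp (-(2 : ℝ) ^ j) * (T (j + 1)).indicator 1 t :=
    fun j t => mul_nonneg (Real.exp_pos _).le (hind0 _ _)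
  -- pointwise domination on `[0,1]`
  have hdom : ∀ t ∈ Icc (0 : ℝ) 1, t ^ n ≤ φ t := by
    intro t ht
    have hsum0 : 0 ≤ ∑ j ∈ Finset.range n, Real.exp (-(2 : ℝ) ^ j) * (T (j + 1)).indicator 1 t :=
      Finset.sum_nonneg fun j _ => hterm0 j t
    by_cases h0 : t ∈ T 0
    · have h1 : (T 0).indicator (1 : ℝ → ℝ) t = 1 := by rw [Set.indicator_of_mem h0]; rfl
      have htn : t ^ n ≤ 1 := pow_le_one₀ ht.1 ht.2
      rw [hφdef]; dsimp only; rw [h1]; linarith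
    · -- bracket: least `j` with `t ∈ T (j+1)`; exists since `2^n ≥ n`
      have hex : ∃ j, t ∈ T (j + 1) := by
        refine ⟨n - 1, ?_, ht.2⟩
        have hpow : (n : ℝ) ≤ (2 : ℝ) ^ (n - 1 + 1) := by
          rw [Nat.sub_add_cancel hn]; exact_mod_cast (Nat.lt_two_pow_self).le
        have : 1 ≤ (2 : ℝ) ^ (n - 1 + 1) / n := by rw [le_div_iff₀ hn0]; linarith
        linarith [ht.1]
      classical
      obtain ⟨j₀, hj₀, hmin⟩ : ∃ j₀, t ∈ T (j₀ + 1) ∧ ∀ j, j < j₀ → t ∉ T (j + 1) :=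
        ⟨Nat.find hex, Nat.find_spec hex, fun j hj => Nat.find_min hex hj⟩
      -- `t ∉ T j₀`
      have hnot : t ∉ T j₀ := by
        rcases j₀ with _ | i
        · exact h0
        · exact hmin i (Nat.lt_succ_self i)
      have hj₀n : j₀ < n := by
        by_contra hge
        replace hge : n ≤ j₀ := not_lt.1 hge
        -- `T n ⊇ [0,1]` hence `t ∈ T (j₀)` … contradiction via monotonicity in `j`
        have hmono : t ∈ T j₀ := by
          refine ⟨?_, ht.2⟩
          have hpow : (n : ℝ) ≤ (2 : ℝ) ^ j₀ :=
            calc (n : ℝ) ≤ (2 : ℝ) ^ n := by exact_mod_cast (Nat.lt_two_pow_self).le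
              _ ≤ (2 : ℝ) ^ j₀ := pow_le_pow_right₀ (by norm_num) hge
          have : 1 ≤ (2 : ℝ) ^ j₀ / n := by rw [le_div_iff₀ hn0]; linarith
          linarith [ht.1]
        exact hnot hmono
      -- `t < 1 - 2^{j₀}/n`, so `tⁿ ≤ (1 - 2^{j₀}/n)ⁿ ≤ e^{-2^{j₀}}`
      have htlt : t < 1 - (2 : ℝ) ^ j₀ / n := by
        by_contra hge
        exact hnot ⟨not_lt.1 hge, ht.2⟩
      set x : ℝ := (2 : ℝ) ^ j₀ / n with hxdef
      have hx0 : 0 ≤ 1 - x := by linarith [ht.1]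
      have htn : t ^ n ≤ Real.exp (-(2 : ℝ) ^ j₀) := by
        calc t ^ n ≤ (1 - x) ^ n := pow_le_pow_left₀ ht.1 htlt.le n
          _ ≤ (Real.exp (-x)) ^ n := pow_le_pow_left₀ hx0 (Real.one_sub_le_exp_neg x) n
          _ = Real.exp (-(2 : ℝ) ^ j₀) := by
              rw [← Real.exp_nat_mul]; congr 1; rw [hxdef]; field_simp
      -- the `j₀`-term of the sum dominates
      have hterm : Real.exp (-(2 : ℝ) ^ j₀) * (T (j₀ + 1)).indicator 1 t = Real.exp (-(2 : ℝ) ^ j₀) := by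
        rw [Set.indicator_of_mem hj₀]; simp
      have hle : Real.exp (-(2 : ℝ) ^ j₀) * (T (j₀ + 1)).indicator 1 t ≤
          ∑ j ∈ Finset.range n, Real.exp (-(2 : ℝ) ^ j) * (T (j + 1)).indicator 1 t :=
        Finset.single_le_sum (fun j _ => hterm0 j t) (Finset.mem_range.2 hj₀n)
      rw [hterm] at hle
      have hI0 : 0 ≤ (T 0).indicator (1 : ℝ → ℝ) t := hind0 0 t
      rw [hφdef]; dsimp only
      linarith
  -- integrate
  have hint : Integrable (fun t : ℝ => t ^ n) ν := AxialTelemetry.integrable_pow hsupp n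
  have hintI : ∀ j, Integrable (fun t => (T j).indicator (1 : ℝ → ℝ) t) ν := fun j =>
    (integrable_const (1 : ℝ)).indicator (hTmeas j)
  have hintT : ∀ j, Integrable (fun t => Real.exp (-(2 : ℝ) ^ j) * (T (j + 1)).indicator 1 t) ν :=
    fun j => (hintI (j + 1)).const_mul _
  have hintS : Integrable (fun t => ∑ j ∈ Finset.range n,
      Real.exp (-(2 : ℝ) ^ j) * (T (j + 1)).indicator 1 t) ν :=
    integrable_finsetSum _ fun j _ => hintT j
  have hintφ : Integrable φ ν := (hintI 0).add hintS
  have hmono : ∫ t, t ^ n ∂ν ≤ ∫ t, φ t ∂ν := by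
    refine integral_mono_ae hint hintφ ?_
    filter_upwards [AxialTelemetry.ae_mem_Icc hsupp] with t ht
    exact hdom t ht
  have hφint : ∫ t, φ t ∂ν = ν.real (T 0) +
      ∑ j ∈ Finset.range n, Real.exp (-(2 : ℝ) ^ j) * ν.real (T (j + 1)) := by
    rw [hφdef]
    dsimp only
    rw [integral_add (hintI 0) hintS, integral_indicator_one (hTmeas 0),
      integral_finsetSum _ (fun j _ => hintT j)]
    congr 1
    refine Finset.sum_congr rfl fun j _ => ?_
    rw [integral_const_mul, integral_indicator_one (hTmeas (j + 1))]
  -- bound each tail: `ν(T j) ≤ C (2^j/n)^{1+κ} = C (2^j)^{1+κ} n^{-(1+κ)}`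
  have htailj : ∀ j, ν.real (T j) ≤ C * ((2 : ℝ) ^ j) ^ (1 + κ) * (n : ℝ) ^ (-(1 + κ)) := by
    intro j
    have h2j : 0 < (2 : ℝ) ^ j := by positivity
    have h := htail ((2 : ℝ) ^ j / n) (by positivity)
    rw [Real.div_rpow h2j.le hn0.le, Real.rpow_neg hn0.le] at *
    calc ν.real (T j) ≤ C * (((2 : ℝ) ^ j) ^ (1 + κ) / (n : ℝ) ^ (1 + κ)) := h
      _ = C * ((2 : ℝ) ^ j) ^ (1 + κ) * ((n : ℝ) ^ (1 + κ))⁻¹ := by rw [div_eq_mul_inv, mul_assoc]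
  -- `(2^{j+1})^{1+κ} ≤ 4^{j+1}` (`κ ≤ 1`)
  have h2pow : ∀ j, ((2 : ℝ) ^ (j + 1)) ^ (1 + κ) ≤ (4 : ℝ) ^ (j + 1) := by
    intro j
    have h1 : (1 : ℝ) ≤ (2 : ℝ) ^ (j + 1) := one_le_pow₀ (by norm_num)
    calc ((2 : ℝ) ^ (j + 1)) ^ (1 + κ) ≤ ((2 : ℝ) ^ (j + 1)) ^ ((2 : ℕ) : ℝ) :=
          Real.rpow_le_rpow_of_exponent_le h1 (by push_cast; linarith)
      _ = (4 : ℝ) ^ (j + 1) := by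
          rw [Real.rpow_natCast, ← pow_mul, mul_comm, pow_mul]; norm_num
  have hnk : 0 < (n : ℝ) ^ (-(1 + κ)) := Real.rpow_pos_of_pos hn0 _
  -- the sum of weights
  have hsumw : ∑ j ∈ Finset.range n, Real.exp (-(2 : ℝ) ^ j) * ν.real (T (j + 1)) ≤
      48 * C * (n : ℝ) ^ (-(1 + κ)) := by
    calc ∑ j ∈ Finset.range n, Real.exp (-(2 : ℝ) ^ j) * ν.real (T (j + 1))
        ≤ ∑ j ∈ Finset.range n, (24 * (1 / 2 : ℝ) ^ j) * (C * (n : ℝ) ^ (-(1 + κ))) := by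
          refine Finset.sum_le_sum fun j _ => ?_
          have hE : 0 ≤ Real.exp (-(2 : ℝ) ^ j) := (Real.exp_pos _).le
          calc Real.exp (-(2 : ℝ) ^ j) * ν.real (T (j + 1))
              ≤ Real.exp (-(2 : ℝ) ^ j) * (C * ((2 : ℝ) ^ (j + 1)) ^ (1 + κ) * (n : ℝ) ^ (-(1 + κ))) :=
                mul_le_mul_of_nonneg_left (htailj (j + 1)) hE
            _ ≤ Real.exp (-(2 : ℝ) ^ j) * (C * (4 : ℝ) ^ (j + 1) * (n : ℝ) ^ (-(1 + κ))) := by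
                gcongr
                exact h2pow j
            _ = (Real.exp (-(2 : ℝ) ^ j) * (4 : ℝ) ^ (j + 1)) * (C * (n : ℝ) ^ (-(1 + κ))) := by ring
            _ ≤ (24 * (1 / 2 : ℝ) ^ j) * (C * (n : ℝ) ^ (-(1 + κ))) :=
                mul_le_mul_of_nonneg_right (exp_neg_two_pow_mul_four_pow_le j) (by positivity)
      _ = 24 * (C * (n : ℝ) ^ (-(1 + κ))) * ∑ j ∈ Finset.range n, (1 / 2 : ℝ) ^ j := by
          rw [Finset.mul_sum]; refine Finset.sum_congr rfl fun j _ => ?_; ring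
      _ ≤ 24 * (C * (n : ℝ) ^ (-(1 + κ))) * 2 :=
          mul_le_mul_of_nonneg_left (sum_geometric_two_le n) (by positivity)
      _ = 48 * C * (n : ℝ) ^ (-(1 + κ)) := by ring
  have hT0 : ν.real (T 0) ≤ C * (n : ℝ) ^ (-(1 + κ)) := by
    have := htailj 0
    simpa using this
  calc ∫ t, t ^ n ∂ν ≤ ∫ t, φ t ∂ν := hmono
    _ = ν.real (T 0) + ∑ j ∈ Finset.range n, Real.exp (-(2 : ℝ) ^ j) * ν.real (T (j + 1)) := hφint
    _ ≤ C * (n : ℝ) ^ (-(1 + κ)) + 48 * C * (n : ℝ) ^ (-(1 + κ)) := add_le_add hT0 hsumw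
    _ = 49 * C * (n : ℝ) ^ (-(1 + κ)) := by ring

end Moments

/-! ### The critical axis two-point function on `ℤ³` -/

/- Existence of a representing measure — the critical axis two-point function of `ℤ³` IS a Hausdorff
moment sequence (Aizenman–Duminil-Copin 2021 Prop. 8.6, DISCHARGED in the tree, at `β_c(3)` through
`m*(β_c) = 0` and `β_c > 0`) — is the landed `AxialTelemetry.axis_hausdorffMoment (i : Fin 3)`. -/

/-- A representing measure of the critical axis two-point function has total mass `⟨σ₀σ₀⟩ = 1`. -/
theorem measureReal_univ_of_moment_rep {ν : Measure ℝ} [IsFiniteMeasure ν]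
    (hrep : ∀ n : ℕ, criticalTwoPoint 3 (Pi.single 0 (n : ℤ)) = ∫ t, t ^ n ∂ν) : ν.real univ = 1 := by
  have h0 := hrep 0
  simp only [pow_zero, integral_const, smul_eq_mul, mul_one, Nat.cast_zero, Pi.single_zero,
    criticalTwoPoint_zero'] at h0
  exact h0.symm

/-- **`EtaPositive` ⟹ spectral gain, for EVERY representing measure.** If the crux holds then any finite
measure `ν` on `[0,1]` with `⟨σ₀σ_{n e₁}⟩⁺_{β_c(3)} = ∫ λⁿ dν` puts weight `ν([1-ε,1]) ≤ C ε^{1+κ}` at the top of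
the spectrum, `ε ∈ (0,1]`, with the crux's own `κ`. -/
theorem spectral_gain_of_EtaPositive (h : Summit.CriticalPhenomena.Ising3DConformalLimit.Theses.AnomalousForcesInteraction.EtaPositive) : ∀ ν : MeasureTheory.Measure ℝ, MeasureTheory.IsFiniteMeasure ν → ν (Set.Icc (0 : ℝ) 1)ᶜ = 0 → (∀ n : ℕ, Literature.Probability.LatticeModels.criticalTwoPoint 3 (Pi.single 0 (n : ℤ)) = ∫ t, t ^ n ∂ν) → ∃ κ C : ℝ, 0 < κ ∧ ∀ ε : ℝ, 0 < ε → ε ≤ 1 → (ν (Set.Icc (1 - ε) 1)).toReal ≤ C * ε ^ (1 + κ) := by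
  intro ν hfin hsupp hrep
  rw [EtaPositive_iff_axis_gain] at h
  obtain ⟨κ, C, hκ, hgain⟩ := h
  have hmass : ν.real univ ≤ 1 := (measureReal_univ_of_moment_rep hrep).le
  have hmom : ∀ n : ℕ, 1 ≤ n → ∫ t, t ^ n ∂ν ≤ C * (n : ℝ) ^ (-(1 + κ)) :=
    fun n hn => (hrep n) ▸ hgain n hn
  exact ⟨κ, (2 * max C 0 + 1) * (4 : ℝ) ^ (1 + κ), hκ,
    fun ε hε0 hε1 => measureReal_Icc_le_of_moments_le hκ hsupp hmass hmom ε hε0 hε1⟩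

/-- **`η(3) > 0` in power form ⟺ a power gain of the Källén–Lehmann spectral weight at threshold.** The crux
`EtaPositive` of route `AnomalousForcesInteraction` is equivalent to: the critical axis two-point function of
the nearest-neighbour Ising model on `ℤ³` is represented, `⟨σ₀σ_{n e₁}⟩⁺_{β_c(3)} = ∫_{[0,1]} λⁿ dν(λ)`, by a
finite positive measure whose weight near the top of the spectrum obeys `ν([1-ε, 1]) ≤ C ε^{1+κ}`
(`ε ∈ (0,1]`) for some `κ > 0` — against the linear rate `ε¹` of a canonical (`η = 0`, free-field-like)
threshold. (Existence of a representing `ν` is unconditional, `AxialTelemetry.axis_hausdorffMoment`; by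
`spectral_gain_of_EtaPositive` the bound then holds for every representing measure.) Registered stub of
stmt-CriticalPhenomena-2600 (verbatim one-line header). -/
theorem EtaPositive_iff_spectral_gain : Summit.CriticalPhenomena.Ising3DConformalLimit.Theses.AnomalousForcesInteraction.EtaPositive ↔ ∃ ν : MeasureTheory.Measure ℝ, MeasureTheory.IsFiniteMeasure ν ∧ ν (Set.Icc (0 : ℝ) 1)ᶜ = 0 ∧ (∀ n : ℕ, Literature.Probability.LatticeModels.criticalTwoPoint 3 (Pi.single 0 (n : ℤ)) = ∫ t, t ^ n ∂ν) ∧ ∃ κ C : ℝ, 0 < κ ∧ ∀ ε : ℝ, 0 < ε → ε ≤ 1 → (ν (Set.Icc (1 - ε) 1)).toReal ≤ C * ε ^ (1 + κ) := by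
  constructor
  · intro h
    obtain ⟨ν, hfin, hsupp, hrep⟩ := AxialTelemetry.axis_hausdorffMoment (0 : Fin 3)
    exact ⟨ν, hfin, hsupp, hrep, spectral_gain_of_EtaPositive h ν hfin hsupp hrep⟩
  · rintro ⟨ν, hfin, hsupp, hrep, κ, C, hκ, htail⟩
    rw [EtaPositive_iff_axis_gain]
    -- normalise: `κ' = min κ 1 ∈ (0,1]`, `C' = max C 1 ≥ 1`, and extend the tail bound to all `ε > 0`
    set κ' : ℝ := min κ 1 with hκ'def
    have hκ'0 : 0 < κ' := lt_min hκ one_pos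
    have hκ'1 : κ' ≤ 1 := min_le_right _ _
    have hκ'κ : κ' ≤ κ := min_le_left _ _
    set C' : ℝ := max C 1 with hC'def
    have hC'1 : 1 ≤ C' := le_max_right _ _
    have hC'0 : 0 ≤ C' := zero_le_one.trans hC'1
    have hmass : ν.real univ = 1 := measureReal_univ_of_moment_rep hrep
    have htail' : ∀ ε : ℝ, 0 < ε → ν.real (Icc (1 - ε) 1) ≤ C' * ε ^ (1 + κ') := by
      intro ε hε
      by_cases hε1 : ε ≤ 1
      · have hp0 : 0 ≤ ε ^ (1 + κ) := Real.rpow_nonneg hε.le _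
        calc ν.real (Icc (1 - ε) 1) ≤ C * ε ^ (1 + κ) := htail ε hε hε1
          _ ≤ C' * ε ^ (1 + κ) := mul_le_mul_of_nonneg_right (le_max_left _ _) hp0
          _ ≤ C' * ε ^ (1 + κ') :=
            mul_le_mul_of_nonneg_left (Real.rpow_le_rpow_of_exponent_ge hε hε1 (by linarith)) hC'0
      · have hε1' : 1 ≤ ε := (not_le.1 hε1).le
        have h1 : 1 ≤ C' * ε ^ (1 + κ') :=
          one_le_mul_of_one_le_of_one_le hC'1 (Real.one_le_rpow hε1' (by linarith))
        calc ν.real (Icc (1 - ε) 1) ≤ ν.real univ := measureReal_mono (subset_univ _)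
          _ = 1 := hmass
          _ ≤ C' * ε ^ (1 + κ') := h1
    have hmom := moments_le_of_measureReal_Icc_le hκ'1 hC'0 hsupp htail'
    refine ⟨κ', 49 * C', hκ'0, fun n hn => ?_⟩
    rw [hrep n]
    exact hmom n hn

end Summit.CriticalPhenomena.Ising3DConformalLimit.AnomalousForcesInteractionEtaPositive
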